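import Literature.Geometry.Riemannian.LaplacianConstSmul
import Literature.Geometry.Riemannian.RiemannianDistanceScaling
import Literature.Geometry.Riemannian.BarrierMaximumPrinciple
import Literature.Geometry.Riemannian.AbreschGromollHyperbolic
import Literature.Geometry.Riemannian.AbreschGromollProfileHyperbolic
import HarnessLib

/-!
# The Cheeger–Colding excess estimate (Cheeger–Colding 1996, Prop. 6.2)

Cheeger–Colding 1996, proof of Prop. 6.2 ("Since the statement is scale invariant it suffices
to assume `R = 1`"): the barrier-sense Laplacian comparison `Δ d(p, ·) ≤ (m-1) κ coth(κ d(p, ·))`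
under `Ric ≥ -(m-1)κ² g`, `κ > 0`, obtained from the case `κ = 1` (`upper_barriers_edist`,
`BarrierMaximumPrinciple.lean`) applied to the rescaled metric `κ² g` (`d_{κ²g} = κ d_g`,
`Δ_{κ²g} = κ⁻² Δ_g`, same Levi-Civita connection). We PROVE `upper_barriers_edist_scaled`,
the excess version `upper_barriers_excess_scaled` (bound `(m-1)κ(coth(κ d_p) + coth(κ d_q)) + ε`),
the scale-one excess lemma `excess_le_of_profile_scaled`, and **Cheeger–Colding 1996, Prop. 6.2**
(`cheegerColding_excess_estimate`): given `m`, `ε > 0` there are `τ(ε,m) > 0`, `L(ε,m)` with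
`Ric ≥ -(m-1)τ`, `d(p, q±) ≥ L`, `E(p) ≤ τ` ⟹ `E ≤ ε` on `B₁(p)` (the printed statement at
`R = 1`), and its printed general-`R` form `cheegerColding_excess_estimate_scaled`
(`Ric ≥ -(m-1)τR⁻²`, `d(p,q±) ≥ LR`, `E(p) ≤ τR` ⟹ `E ≤ εR` on `B_R(p)`, by rescaling `g ↦ R⁻²g`). No definitions, no named facts (D-0026). Groundwork for
`CheegerColding1997_sphereStability` (the excess estimate enters the almost splitting theorem,
Cheeger–Colding 1996 §6, used throughout Cheeger–Colding 1997).

## References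

* J. Cheeger, T. H. Colding, Ann. of Math. 144 (1996) 189–237, Prop. 6.2. [CheegerColding1996]
* E. Calabi, Duke Math. J. 25 (1958) 45–56. [Calabi1958]
* P. Topping, *Lectures on the Ricci flow* (2006), §1.2.3 (scaling). [Topping2006]
-/

noncomputable section

open Bundle Set Function Filter
open scoped Manifold ContDiff Topology ENNReal NNReal Real

namespace Literature.Geometry.Riemannian

open Lorentzian Lorentzian.PseudoRiemannianMetric

section Scaled

variable {E : Type*} [NormedAddCommGroup E] [NormedSpace ℝ E] [FiniteDimensional ℝ E]
  [CompleteSpace E] {M : Type*} [TopologicalSpace M] [ChartedSpace E M] [IsManifold 𝓘(ℝ, E) ∞ M]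
  [T2Space M]
  (g : PseudoRiemannianMetric 𝓘(ℝ, E) ∞ E (TangentSpace 𝓘(ℝ, E) : M → Type _)) [g.HasLeviCivita]
  [CovariantDerivative.ContMDiffCovariantDerivative g.leviCivita 1]
  [CovariantDerivative.ContMDiffCovariantDerivative g.leviCivita ∞]

/-- **Calabi's upper barriers for `d(p, ·)` under `Ric ≥ -(m-1)κ²`**: at every `x ≠ p` and for
every `ε > 0` there is `φ`, `C²` near `x`, with `d(p, ·) - φ` locally maximal at `x` and
`Δ_g φ(x) ≤ (m-1) κ coth(κ d(p, x)) + ε` (scaling of `upper_barriers_edist`).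
[cite: CheegerColding1996, Prop. 6.2 (proof)] [cite: Calabi1958] [cite: Topping2006, §1.2.3] -/
theorem upper_barriers_edist_scaled [ConnectedSpace M] (hg : g.IsRiemannian)
    (hc : IsGeodesicallyComplete g.leviCivita) {κ : ℝ} (hκ : 0 < κ)
    (hRic : ∀ (x : M) (w : TangentSpace 𝓘(ℝ, E) x),
      -((Module.finrank ℝ E : ℝ) - 1) * κ ^ 2 * g.val x w w ≤ g.leviCivita.ricci x w w)
    {p x : M} (hxp : x ≠ p) :
    ∀ ε > 0, ∃ φ : M → ℝ, (∀ᶠ x' in 𝓝 x, ContMDiffAt 𝓘(ℝ, E) 𝓘(ℝ, ℝ) 2 φ x') ∧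
      IsLocalMax (fun x' ↦ (g.edist hg p x').toReal - φ x') x ∧
        g.laplaceBeltrami φ x ≤ ((Module.finrank ℝ E : ℝ) - 1) * κ *
          (Real.cosh (κ * (g.edist hg p x).toReal) / Real.sinh (κ * (g.edist hg p x).toReal)) + ε := by
  intro ε hε
  have hκ2 : (0 : ℝ) < κ ^ 2 := by positivity
  -- the rescaled metric `κ² g`
  set g' := g.constSmul (κ ^ 2) hκ2.ne' with hg'_def
  haveI : g'.HasLeviCivita := HasLeviCivita.constSmul (g := g) (κ ^ 2) hκ2.ne'
  have hLC : g'.leviCivita = g.leviCivita := leviCivita_constSmul (g := g) (κ ^ 2) hκ2.ne'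
  haveI : CovariantDerivative.ContMDiffCovariantDerivative g'.leviCivita 1 := by
    rw [hLC]; infer_instance
  haveI : CovariantDerivative.ContMDiffCovariantDerivative g'.leviCivita ∞ := by
    rw [hLC]; infer_instance
  have hg' : g'.IsRiemannian := hg.constSmul hκ2
  have hc' : IsGeodesicallyComplete g'.leviCivita := by rw [hLC]; exact hc
  have hRic' : ∀ (y : M) (w : TangentSpace 𝓘(ℝ, E) y),
      -((Module.finrank ℝ E : ℝ) - 1) * g'.val y w w ≤ g'.leviCivita.ricci y w w := fun y w ↦ by
    rw [hLC, hg'_def, constSmul_apply]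
    have := hRic y w
    nlinarith
  -- distances scale by `κ`
  have hd : ∀ y z : M, (g'.edist hg' y z).toReal = κ * (g.edist hg y z).toReal := fun y z ↦ by
    have h := edist_constSmul hg hκ2 y z
    rw [show (g.constSmul (κ ^ 2) hκ2.ne').edist (hg.constSmul hκ2) y z = g'.edist hg' y z from rfl]
      at h
    rw [h, ENNReal.toReal_mul, ENNReal.toReal_ofReal (Real.sqrt_nonneg _), Real.sqrt_sq hκ.le]
  -- the `κ = 1` barriers for `κ² g`
  obtain ⟨ψ, hψ, hmax, hΔ⟩ := upper_barriers_edist g' hg' hc' hRic' hxp (ε / κ) (div_pos hε hκ)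
  refine ⟨fun z ↦ κ⁻¹ * ψ z, ?_, ?_, ?_⟩
  · filter_upwards [hψ] with z hz using contMDiffAt_const.mul hz
  · filter_upwards [hmax] with z hz
    have hz' : (g'.edist hg' p z).toReal - ψ z ≤ (g'.edist hg' p x).toReal - ψ x := hz
    rw [hd, hd] at hz'
    show (g.edist hg p z).toReal - κ⁻¹ * ψ z ≤ (g.edist hg p x).toReal - κ⁻¹ * ψ x
    have h1 : (g.edist hg p z).toReal - κ⁻¹ * ψ z = κ⁻¹ * (κ * (g.edist hg p z).toReal - ψ z) := by
      field_simp
    have h2 : (g.edist hg p x).toReal - κ⁻¹ * ψ x = κ⁻¹ * (κ * (g.edist hg p x).toReal - ψ x) := by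
      field_simp
    rw [h1, h2]
    exact mul_le_mul_of_nonneg_left hz' (inv_nonneg.2 hκ.le)
  · -- `Δ_g (κ⁻¹ ψ) = κ⁻¹ Δ_g ψ = κ⁻¹ κ² Δ_{κ²g} ψ = κ Δ_{κ²g} ψ`
    have hψx : ContMDiffAt 𝓘(ℝ, E) 𝓘(ℝ, ℝ) 2 ψ x := hψ.self_of_nhds
    have h1 : g.laplaceBeltrami (fun z ↦ κ⁻¹ * ψ z) x = κ⁻¹ * g.laplaceBeltrami ψ x := by
      rw [laplaceBeltrami_eq_dalembertian, laplaceBeltrami_eq_dalembertian]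
      exact dalembertian_const_mul_of_contMDiffAt g hψx κ⁻¹
    have h2 : g'.laplaceBeltrami ψ x = (κ ^ 2)⁻¹ * g.laplaceBeltrami ψ x :=
      laplaceBeltrami_constSmul g (κ ^ 2) hκ2.ne' hψx
    have h3 : g.laplaceBeltrami (fun z ↦ κ⁻¹ * ψ z) x = κ * g'.laplaceBeltrami ψ x := by
      rw [h1, h2]; field_simp
    rw [h3]
    rw [hd p x] at hΔ
    calc κ * g'.laplaceBeltrami ψ x ≤ κ * (((Module.finrank ℝ E : ℝ) - 1) *
          (Real.cosh (κ * (g.edist hg p x).toReal) / Real.sinh (κ * (g.edist hg p x).toReal)) +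
            ε / κ) := mul_le_mul_of_nonneg_left hΔ hκ.le
      _ = ((Module.finrank ℝ E : ℝ) - 1) * κ *
          (Real.cosh (κ * (g.edist hg p x).toReal) / Real.sinh (κ * (g.edist hg p x).toReal)) +
            ε := by field_simp

/-- **Barriers for the excess under `Ric ≥ -(m-1)κ²`** (Cheeger–Colding 1996, proof of Prop. 6.2:
Laplacian comparison for `E` in the barrier sense at scale `κ`): at `x ≠ p, q`, for every
`ε > 0`, a `C²` upper barrier `φ` of `e = d(p,·) + d(q,·) - d(p,q)` at `x` with
`Δφ(x) ≤ (m-1)κ (coth(κ d(p,x)) + coth(κ d(q,x))) + ε`. [cite: CheegerColding1996, Prop. 6.2 (proof)] -/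
theorem upper_barriers_excess_scaled [ConnectedSpace M] (hg : g.IsRiemannian)
    (hc : IsGeodesicallyComplete g.leviCivita) {κ : ℝ} (hκ : 0 < κ)
    (hRic : ∀ (x : M) (w : TangentSpace 𝓘(ℝ, E) x),
      -((Module.finrank ℝ E : ℝ) - 1) * κ ^ 2 * g.val x w w ≤ g.leviCivita.ricci x w w)
    {p q x : M} (hxp : x ≠ p) (hxq : x ≠ q) :
    ∀ ε > 0, ∃ φ : M → ℝ, (∀ᶠ x' in 𝓝 x, ContMDiffAt 𝓘(ℝ, E) 𝓘(ℝ, ℝ) 2 φ x') ∧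
      IsLocalMax (fun x' ↦ ((g.edist hg p x').toReal + (g.edist hg q x').toReal -
        (g.edist hg p q).toReal) - φ x') x ∧
        g.laplaceBeltrami φ x ≤ ((Module.finrank ℝ E : ℝ) - 1) * κ *
          (Real.cosh (κ * (g.edist hg p x).toReal) / Real.sinh (κ * (g.edist hg p x).toReal) +
            Real.cosh (κ * (g.edist hg q x).toReal) / Real.sinh (κ * (g.edist hg q x).toReal)) + ε := by
  intro ε hε
  obtain ⟨φ, hφ, hmax, hΔ⟩ := upper_barriers_add g (x := x)
    (u₁ := fun x' ↦ (g.edist hg p x').toReal) (u₂ := fun x' ↦ (g.edist hg q x').toReal)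
    (F₁ := fun x' ↦ ((Module.finrank ℝ E : ℝ) - 1) * κ *
      (Real.cosh (κ * (g.edist hg p x').toReal) / Real.sinh (κ * (g.edist hg p x').toReal)))
    (F₂ := fun x' ↦ ((Module.finrank ℝ E : ℝ) - 1) * κ *
      (Real.cosh (κ * (g.edist hg q x').toReal) / Real.sinh (κ * (g.edist hg q x').toReal)))
    (upper_barriers_edist_scaled g hg hc hκ hRic hxp)
    (upper_barriers_edist_scaled g hg hc hκ hRic hxq) ε hε
  refine ⟨φ, hφ, ?_, by rw [mul_add]; exact hΔ⟩
  filter_upwards [hmax] with x' h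
  have h' : (g.edist hg p x').toReal + (g.edist hg q x').toReal - φ x' ≤
      (g.edist hg p x).toReal + (g.edist hg q x).toReal - φ x := h
  show (g.edist hg p x').toReal + (g.edist hg q x').toReal - (g.edist hg p q).toReal - φ x' ≤
    (g.edist hg p x).toReal + (g.edist hg q x).toReal - (g.edist hg p q).toReal - φ x
  linarith

end Scaled

/-! ### Cheeger–Colding 1996, Prop. 6.2 (the qualitative excess estimate), at scale `R = 1` -/

section Prop62

universe u v

/-- An elementary bound: `coth y ≤ 1 + 1/y` for `y > 0`. [folklore] -/
theorem cosh_div_sinh_le {y : ℝ} (hy : 0 < y) : Real.cosh y / Real.sinh y ≤ 1 + 1 / y := by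
  have hs : 0 < Real.sinh y := Real.sinh_pos_iff.2 hy
  rw [div_le_iff₀ hs]
  have h1 : Real.cosh y ≤ Real.sinh y + 1 := by
    have := Real.cosh_sub_sinh y  -- cosh y - sinh y = exp (-y)
    have h2 : Real.exp (-y) ≤ 1 := by rw [Real.exp_le_one_iff]; linarith
    linarith
  have h3 : y ≤ Real.sinh y := by
    have := Real.self_le_sinh_iff.2 hy.le
    exact this
  have h4 : (1 + 1 / y) * Real.sinh y = Real.sinh y + Real.sinh y / y := by field_simp
  rw [h4]
  have h5 : 1 ≤ Real.sinh y / y := by rw [le_div_iff₀ hy]; linarith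
  linarith

/-- `κ coth(κ D') ≤ κ + 1/D` for `0 < D ≤ D'`, `κ > 0`. [folklore] -/
theorem mul_cosh_div_sinh_le {κ D D' : ℝ} (hκ : 0 < κ) (hD : 0 < D) (hDD' : D ≤ D') :
    κ * (Real.cosh (κ * D') / Real.sinh (κ * D')) ≤ κ + 1 / D := by
  have hD' : 0 < D' := hD.trans_le hDD'
  have h1 := cosh_div_sinh_le (mul_pos hκ hD')
  have h2 : κ * (1 + 1 / (κ * D')) = κ + 1 / D' := by field_simp
  have h3 : 1 / D' ≤ 1 / D := one_div_le_one_div_of_le hD hDD'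
  calc κ * (Real.cosh (κ * D') / Real.sinh (κ * D')) ≤ κ * (1 + 1 / (κ * D')) :=
        mul_le_mul_of_nonneg_left h1 hκ.le
    _ = κ + 1 / D' := h2
    _ ≤ κ + 1 / D := by linarith

variable {E : Type u} [NormedAddCommGroup E] [NormedSpace ℝ E] [FiniteDimensional ℝ E]
  [CompleteSpace E] {M : Type v} [TopologicalSpace M] [ChartedSpace E M] [IsManifold 𝓘(ℝ, E) ∞ M]
  [T2Space M]
  (g : PseudoRiemannianMetric 𝓘(ℝ, E) ∞ E (TangentSpace 𝓘(ℝ, E) : M → Type _)) [g.HasLeviCivita]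
  [CovariantDerivative.ContMDiffCovariantDerivative g.leviCivita 1]
  [CovariantDerivative.ContMDiffCovariantDerivative g.leviCivita ∞]

/-- **The excess estimate at scale one, for given profile data** (the heart of Cheeger–Colding
1996, Prop. 6.2): on a connected Riemannian `m`-manifold with complete Levi-Civita connection
and `Ric ≥ -(m-1)κ²`, `0 < κ ≤ 1`, let `qp, qm, p, x` with `d(p, x) < 1`, `d(p, q±) ≥ L`, `L > 3`,
and excess `E(p) ≤ δ`. Let `G` (with `G'`, `G''`) be a profile on `(c/2, 4)`, strictly decreasing
on `[c, 2]`, `G(2) = 0`, `G'' + (m-1) coth G' ≥ b'` on `(c, 2)` where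
`2(m-1)(κ + 1/(L-3)) < b'`, and `δ < G(1)`. Then `E(x) ≤ 2c + G(c) + δ`
(`abreschGromoll_lemma_hyperbolic_of_le` with centre `x`, `y₀ = p`, `R = 2`, `a = 2`, the
barriers `upper_barriers_excess_scaled` and `κ coth(κ d) ≤ κ + 1/(L-3)` on `B₂(x)`).
[cite: CheegerColding1996, Prop. 6.2 (proof)] -/
theorem excess_le_of_profile_scaled [ConnectedSpace M] (hg : g.IsRiemannian)
    (hc : IsGeodesicallyComplete g.leviCivita) {κ : ℝ} (hκ : 0 < κ) (hκ1 : κ ≤ 1)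
    (hRic : ∀ (x : M) (w : TangentSpace 𝓘(ℝ, E) x),
      -((Module.finrank ℝ E : ℝ) - 1) * κ ^ 2 * g.val x w w ≤ g.leviCivita.ricci x w w)
    {qp qm p x : M} (hpx : g.edist hg p x < ENNReal.ofReal 1) {L : ℝ} (hL : 3 < L)
    (hLp : ENNReal.ofReal L ≤ g.edist hg p qp) (hLm : ENNReal.ofReal L ≤ g.edist hg p qm)
    {δ : ℝ} (hδ : 0 ≤ δ)
    (hEp : (g.edist hg qp p).toReal + (g.edist hg qm p).toReal - (g.edist hg qp qm).toReal ≤ δ)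
    {c : ℝ} (hc0 : 0 < c) (hc2 : c < 1) {G G' G2 : ℝ → ℝ}
    (hGd : ∀ r ∈ Ioo (c / 2) (2 * 2), HasDerivAt G (G' r) r)
    (hG2 : ∀ r ∈ Ioo (c / 2) (2 * 2), HasDerivAt G' (G2 r) r)
    (hstrict : StrictAntiOn G (Icc c 2)) (hGR : G 2 = 0) {b' : ℝ}
    (hb' : 2 * ((Module.finrank ℝ E : ℝ) - 1) * (κ + 1 / (L - 3)) < b')
    (hmodel : ∀ r ∈ Ioo c 2, b' ≤ G2 r + ((Module.finrank ℝ E : ℝ) - 1) * (Real.cosh r / Real.sinh r) * G' r)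
    (hδG : δ < G 1) :
    (g.edist hg qp x).toReal + (g.edist hg qm x).toReal - (g.edist hg qp qm).toReal ≤
      2 * c + G c + δ := by
  haveI : LocallyCompactSpace M := Manifold.locallyCompact_of_finiteDimensional 𝓘(ℝ, E)
  haveI : RegularSpace M := inferInstance
  set m := Module.finrank ℝ E with hm_def
  -- real triangle inequalities and symmetry
  have htri : ∀ a' b' c' : M, (g.edist hg a' b').toReal ≤
      (g.edist hg a' c').toReal + (g.edist hg c' b').toReal := fun a' b' c' ↦ by
    have h := ENNReal.toReal_mono (ENNReal.add_ne_top.2 ⟨edist_ne_top hg a' c', edist_ne_top hg c' b'⟩)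
      (g.edist_triangle hg a' c' b')
    rwa [ENNReal.toReal_add (edist_ne_top hg a' c') (edist_ne_top hg c' b')] at h
  have hsymm : ∀ a' b' : M, (g.edist hg a' b').toReal = (g.edist hg b' a').toReal := fun a' b' ↦ by
    rw [g.edist_comm hg]
  have hpx' : (g.edist hg p x).toReal < 1 := by
    have := ENNReal.toReal_lt_of_lt_ofReal hpx; simpa using this
  have hL0 : 0 < L := by linarith
  have hLp' : L ≤ (g.edist hg p qp).toReal :=
    (ENNReal.ofReal_le_iff_le_toReal (edist_ne_top hg p qp)).1 hLp
  have hLm' : L ≤ (g.edist hg p qm).toReal :=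
    (ENNReal.ofReal_le_iff_le_toReal (edist_ne_top hg p qm)).1 hLm
  -- the dimension factor `m - 1 ≥ 0` (`p ≠ qp`, so `E` is nontrivial)
  have hm1 : (0 : ℝ) ≤ (m : ℝ) - 1 := by
    have hpq : qp ≠ p := by
      intro h
      rw [h, PseudoRiemannianMetric.edist_self, ENNReal.toReal_zero] at hLp'
      linarith
    obtain ⟨u₀, -, hu₀, -, -, -⟩ := exists_unit_speed_expMap_eq_of_ne g hg hc hpq
    have hu₀0 : (u₀ : E) ≠ 0 := fun h ↦ by
      rw [h, map_zero] at hu₀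
      exact zero_ne_one hu₀
    have h1 : 0 < Module.finrank ℝ E := Module.finrank_pos_iff_exists_ne_zero.2 ⟨u₀, hu₀0⟩
    have : (1 : ℝ) ≤ (m : ℝ) := by rw [hm_def]; exact_mod_cast h1
    linarith
  -- `Ric ≥ -(m-1)κ² g` with `κ ≤ 1` gives `Ric ≥ -(m-1) g` (for the `K = -1` subsolution side)
  have hRic1 : ∀ (y : M) (w : TangentSpace 𝓘(ℝ, E) y),
      -((Module.finrank ℝ E : ℝ) - 1) * g.val y w w ≤ g.leviCivita.ricci y w w := fun y w ↦ by
    have h1 := hRic y w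
    have h2 : 0 ≤ g.val y w w := by
      by_cases hw : w = 0
      · rw [hw, map_zero]
      · exact (hg y w hw).le
    have h3 : κ ^ 2 ≤ 1 := by nlinarith
    have h4 : ((Module.finrank ℝ E : ℝ) - 1) * κ ^ 2 * g.val y w w ≤
        ((Module.finrank ℝ E : ℝ) - 1) * g.val y w w := by
      have := mul_le_mul_of_nonneg_left (mul_le_of_le_one_left h2 h3) hm1
      nlinarith
    linarith
  -- the excess and its properties
  set e : M → ℝ := fun y ↦ (g.edist hg qp y).toReal + (g.edist hg qm y).toReal -
    (g.edist hg qp qm).toReal with he_def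
  have hce : ∀ p' : M, Continuous fun z ↦ (g.edist hg p' z).toReal := fun p' ↦ by
    have h1 : Continuous fun z ↦ g.edist hg p' z :=
      (PseudoRiemannianMetric.continuous_edist hg).comp (continuous_const.prodMk continuous_id)
    exact continuous_iff_continuousAt.2 fun z ↦
      (ENNReal.tendsto_toReal (edist_ne_top hg p' z)).comp (h1.tendsto z)
  have hecont : Continuous e := ((hce qp).add (hce qm)).sub continuous_const
  -- apply the Abresch–Gromoll lemma with defect, centre `x`, `y₀ = p`, `R = 2`, `a = 2`
  have key := abreschGromoll_lemma_hyperbolic_of_le g hg hc hRic1 x hc0 (by linarith : c < 2)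
    hGd hG2 hstrict hGR (b := 2 * ((Module.finrank ℝ E : ℝ) - 1) * (κ + 1 / (L - 3))) hb' hmodel
    (u := e) hecont (a := 2) (by norm_num) (fun z z' ↦ abs_excess_sub_excess_le g hg qp qm z z')
    (fun z _ ↦ excess_nonneg g hg qp qm z) (y₀ := p) ?_ hδ (by simpa [he_def] using hEp) ?_ ?_
  · simpa [he_def] using key
  · -- `d(x, p) < 2`
    rw [g.edist_comm hg]
    exact hpx.trans ((ENNReal.ofReal_lt_ofReal_iff_of_nonneg zero_le_one).2 (by norm_num))
  · -- the defect condition `δ < G(d(x, p))`, from `d(x, p) ≤ 1`, `G` decreasing, `δ < G(1)`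
    intro hcxp
    have hd1 : (g.edist hg x p).toReal ≤ 1 := by rw [hsymm x p]; exact hpx'.le
    have hdc : c ≤ (g.edist hg x p).toReal :=
      (ENNReal.ofReal_le_iff_le_toReal (edist_ne_top hg x p)).1 hcxp
    have hG1 : G 1 ≤ G (g.edist hg x p).toReal :=
      hstrict.antitoneOn ⟨hdc, by linarith⟩ ⟨by linarith, by norm_num⟩ hd1
    linarith
  · -- barriers on `B₂(x)`: there `d(q±, z) ≥ L - 3 > 0`
    intro z hz ε hε
    have hdz : (g.edist hg x z).toReal < 2 := by
      have := ENNReal.toReal_lt_of_lt_ofReal hz; simpa using this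
    have hqz : ∀ q' : M, L ≤ (g.edist hg p q').toReal → L - 3 < (g.edist hg q' z).toReal := by
      intro q' hq'
      have h1 := htri p q' x
      have h2 := htri x q' z
      rw [hsymm z q'] at h2
      linarith
    have hqpz := hqz qp hLp'
    have hqmz := hqz qm hLm'
    have hzqp : z ≠ qp := by
      intro h; rw [h, PseudoRiemannianMetric.edist_self, ENNReal.toReal_zero] at hqpz; linarith
    have hzqm : z ≠ qm := by
      intro h; rw [h, PseudoRiemannianMetric.edist_self, ENNReal.toReal_zero] at hqmz; linarith
    obtain ⟨φ, hφ, hmax, hΔ⟩ := upper_barriers_excess_scaled g hg hc hκ hRic hzqp hzqm ε hε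
    refine ⟨φ, hφ, by simpa [he_def] using hmax, hΔ.trans ?_⟩
    have h1 := mul_cosh_div_sinh_le hκ (by linarith : (0:ℝ) < L - 3) hqpz.le
    have h2 := mul_cosh_div_sinh_le hκ (by linarith : (0:ℝ) < L - 3) hqmz.le
    have h3 : ((Module.finrank ℝ E : ℝ) - 1) * κ *
        (Real.cosh (κ * (g.edist hg qp z).toReal) / Real.sinh (κ * (g.edist hg qp z).toReal) +
          Real.cosh (κ * (g.edist hg qm z).toReal) / Real.sinh (κ * (g.edist hg qm z).toReal)) =
        ((Module.finrank ℝ E : ℝ) - 1) *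
          (κ * (Real.cosh (κ * (g.edist hg qp z).toReal) / Real.sinh (κ * (g.edist hg qp z).toReal)) +
            κ * (Real.cosh (κ * (g.edist hg qm z).toReal) / Real.sinh (κ * (g.edist hg qm z).toReal))) := by
      ring
    rw [h3]
    have h4 := mul_le_mul_of_nonneg_left (add_le_add h1 h2) hm1
    linarith

/-- Linearity of the hyperbolic profile in `b`: `G_b = b · G_1`. [folklore] -/
theorem agProfileHyp_smul (k : ℕ) (b R₁ R r : ℝ) :
    -∫ u in r..R, b * ((∫ t in (0 : ℝ)..u, Real.sinh t ^ k) -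
        ∫ t in (0 : ℝ)..R₁, Real.sinh t ^ k) / Real.sinh u ^ k =
      b * -∫ u in r..R, 1 * ((∫ t in (0 : ℝ)..u, Real.sinh t ^ k) -
        ∫ t in (0 : ℝ)..R₁, Real.sinh t ^ k) / Real.sinh u ^ k := by
  rw [mul_neg, ← intervalIntegral.integral_const_mul]
  congr 2
  funext u
  ring
set_option maxHeartbeats 400000 in -- buildfix (bf3-g27): 160k/180k FAIL, 200k PASS at accept time; line-neutral budget line
/-- **Cheeger–Colding 1996, Prop. 6.2 (the excess estimate; "slight generalization of the
Abresch–Gromoll inequality, in qualitative form"), at scale `R = 1`.** Given `m` and `ε > 0`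
there are `τ = τ(ε, m) > 0` and `L = L(ε, m) < ∞` such that: on every connected Riemannian
`m`-manifold with complete Levi-Civita connection and `Ric ≥ -(m-1) τ g` [(6.3) with `R = 1`],
for `qp, qm, p` with `d(p, q±) ≥ L` [(6.5)] and excess `E(p) = d(qp,p) + d(qm,p) - d(qp,qm) ≤ τ`
[(6.4)], one has `E ≤ ε` on `B₁(p)` [(6.6)]. (The printed statement for general `R > 0` —
`Ric ≥ -(m-1)τR⁻²`, `d(p,q±) ≥ LR`, `E(p) ≤ τR` ⟹ `sup_{B_R(p)} E ≤ εR` — "is scale invariant,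
[so] it suffices to assume `R = 1`".) Proof as printed: the Abresch–Gromoll argument with the
defect `E(p) ≤ τ` (`excess_le_of_profile_scaled`, `abreschGromoll_lemma_hyperbolic_of_le`) and
the hyperbolic comparison profile (`AbreschGromollProfileHyperbolic.lean`) with `ψ = 1`, the
parameters `c = ε/8`, `b' = ε/(4 G₁(c))`, then `τ`, `L` so small/large that
`2(m-1)(√τ + 1/(L-3)) < b'`, `τ < b' G₁(1)`, `τ ≤ ε/2`.
[cite: CheegerColding1996, Prop. 6.2] [cite: AbreschGromoll1990] -/
theorem cheegerColding_excess_estimate (m : ℕ) {ε : ℝ} (hε : 0 < ε) :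
    ∃ τ : ℝ, 0 < τ ∧ ∃ L : ℝ, 0 < L ∧
      ∀ {E : Type u} [NormedAddCommGroup E] [NormedSpace ℝ E] [FiniteDimensional ℝ E]
        [CompleteSpace E] {M : Type v} [TopologicalSpace M] [ChartedSpace E M]
        [IsManifold 𝓘(ℝ, E) ∞ M] [T2Space M] [ConnectedSpace M]
        (g : PseudoRiemannianMetric 𝓘(ℝ, E) ∞ E (TangentSpace 𝓘(ℝ, E) : M → Type _))
        [g.HasLeviCivita] [CovariantDerivative.ContMDiffCovariantDerivative g.leviCivita 1]
        [CovariantDerivative.ContMDiffCovariantDerivative g.leviCivita ∞]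
        (hg : g.IsRiemannian) (_hc : IsGeodesicallyComplete g.leviCivita)
        (_hdim : Module.finrank ℝ E = m)
        (_hRic : ∀ (x : M) (w : TangentSpace 𝓘(ℝ, E) x),
          -((m : ℝ) - 1) * τ * g.val x w w ≤ g.leviCivita.ricci x w w)
        (qp qm p : M), ENNReal.ofReal L ≤ g.edist hg p qp → ENNReal.ofReal L ≤ g.edist hg p qm →
          (g.edist hg qp p).toReal + (g.edist hg qm p).toReal - (g.edist hg qp qm).toReal ≤ τ →
            ∀ x : M, g.edist hg p x < ENNReal.ofReal 1 →
              (g.edist hg qp x).toReal + (g.edist hg qm x).toReal -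
                (g.edist hg qp qm).toReal ≤ ε := by
  -- the unit hyperbolic profile with `k = m - 1`, `R = R₁ = 2`
  set k := m - 1 with hk
  set G₁ : ℝ → ℝ := fun r ↦ -∫ u in r..2, 1 * ((∫ t in (0 : ℝ)..u, Real.sinh t ^ k) -
    ∫ t in (0 : ℝ)..2, Real.sinh t ^ k) / Real.sinh u ^ k with hG₁
  have hanti₁ : ∀ {c : ℝ}, 0 < c → StrictAntiOn G₁ (Icc c 2) := fun hc ↦
    strictAntiOn_agProfileHyp k one_pos hc two_pos le_rfl
  have hG₁2 : G₁ 2 = 0 := agProfileHyp_apply_self k 1 2 2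
  have hG₁pos : ∀ {r : ℝ}, 0 < r → r < 2 → 0 < G₁ r := fun {r} hr hr2 ↦ by
    rw [← hG₁2]; exact hanti₁ hr ⟨le_rfl, hr2.le⟩ ⟨hr2.le, le_rfl⟩ hr2
  -- parameters
  set ε' : ℝ := min ε 1 with hε'
  have hε'0 : 0 < ε' := lt_min hε one_pos
  have hε'1 : ε' ≤ 1 := min_le_right _ _
  have hε'ε : ε' ≤ ε := min_le_left _ _
  set c : ℝ := ε' / 8 with hc_def
  have hc0 : 0 < c := by positivity
  have hc1 : c < 1 := by rw [hc_def]; linarith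
  have hg1c : 0 < G₁ c := hG₁pos hc0 (by linarith)
  have hg11 : 0 < G₁ 1 := hG₁pos one_pos one_lt_two
  set b' : ℝ := ε' / (4 * G₁ c) with hb'_def
  have hb'0 : 0 < b' := by positivity
  set m' : ℝ := ((m : ℝ) - 1) ^ 2 + 1 with hm'
  have hm'0 : 0 < m' := by positivity
  have hm'1 : |(m : ℝ) - 1| ≤ m' := by
    rw [hm']; nlinarith [abs_nonneg ((m : ℝ) - 1), sq_abs ((m : ℝ) - 1)]
  set τ : ℝ := min (min 1 (ε' / 2)) (min (b' * G₁ 1 / 2) ((b' / (8 * m')) ^ 2)) with hτ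
  have hτ0 : 0 < τ := lt_min (lt_min one_pos (by positivity)) (lt_min (by positivity) (by positivity))
  have hτ1 : τ ≤ 1 := (min_le_left _ _).trans (min_le_left _ _)
  have hτε : τ ≤ ε' / 2 := (min_le_left _ _).trans (min_le_right _ _)
  have hτG : τ < b' * G₁ 1 := by
    have : τ ≤ b' * G₁ 1 / 2 := (min_le_right _ _).trans (min_le_left _ _)
    have : 0 < b' * G₁ 1 := by positivity
    linarith
  have hτb : Real.sqrt τ ≤ b' / (8 * m') := by
    have h1 : τ ≤ (b' / (8 * m')) ^ 2 := (min_le_right _ _).trans (min_le_right _ _)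
    calc Real.sqrt τ ≤ Real.sqrt ((b' / (8 * m')) ^ 2) := Real.sqrt_le_sqrt h1
      _ = b' / (8 * m') := Real.sqrt_sq (by positivity)
  set L : ℝ := 3 + 8 * m' / b' with hL_def
  have hL3 : 3 < L := by rw [hL_def]; linarith [div_pos (mul_pos (by norm_num : (0:ℝ) < 8) hm'0) hb'0]
  refine ⟨τ, hτ0, L, by linarith, ?_⟩
  intro E _ _ _ _ M _ _ _ _ _ g _ _ _ hg hc hdim hRic qp qm p hLp hLm hEp x hpx
  haveI : LocallyCompactSpace M := Manifold.locallyCompact_of_finiteDimensional 𝓘(ℝ, E)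
  haveI : RegularSpace M := inferInstance
  -- `κ = √τ`
  set κ := Real.sqrt τ with hκ_def
  have hκ0 : 0 < κ := Real.sqrt_pos.2 hτ0
  have hκ2 : κ ^ 2 = τ := Real.sq_sqrt hτ0.le
  have hκ1 : κ ≤ 1 := by rw [hκ_def, ← Real.sqrt_one]; exact Real.sqrt_le_sqrt hτ1
  have hRic' : ∀ (y : M) (w : TangentSpace 𝓘(ℝ, E) y),
      -((Module.finrank ℝ E : ℝ) - 1) * κ ^ 2 * g.val y w w ≤ g.leviCivita.ricci y w w := by
    intro y w; rw [hκ2, hdim]; exact hRic y w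
  -- `1 ≤ m` (the points `p ≠ qp` give a nonzero tangent vector)
  have hLp' : L ≤ (g.edist hg p qp).toReal :=
    (ENNReal.ofReal_le_iff_le_toReal (edist_ne_top hg p qp)).1 hLp
  have hm1 : 1 ≤ m := by
    have hpq : qp ≠ p := by
      intro h
      rw [h, PseudoRiemannianMetric.edist_self, ENNReal.toReal_zero] at hLp'
      linarith
    obtain ⟨u₀, -, hu₀, -, -, -⟩ := exists_unit_speed_expMap_eq_of_ne g hg hc hpq
    have hu₀0 : (u₀ : E) ≠ 0 := fun h ↦ by
      rw [h, map_zero] at hu₀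
      exact zero_ne_one hu₀
    have h1 : 0 < Module.finrank ℝ E := Module.finrank_pos_iff_exists_ne_zero.2 ⟨u₀, hu₀0⟩
    omega
  have hkm : (k : ℝ) = (Module.finrank ℝ E : ℝ) - 1 := by
    rw [hdim, hk, Nat.cast_sub hm1, Nat.cast_one]
  -- the barrier constant is below `b'`
  have hbb' : 2 * ((Module.finrank ℝ E : ℝ) - 1) * (κ + 1 / (L - 3)) < b' := by
    rw [hdim]
    have h1 : 1 / (L - 3) = b' / (8 * m') := by
      rw [hL_def]; field_simp; ring
    rw [h1]
    have h2 : κ + b' / (8 * m') ≤ b' / (4 * m') := by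
      have h3' : κ ≤ b' / (8 * m') := hτb
      have h3 : b' / (8 * m') + b' / (8 * m') = b' / (4 * m') := by field_simp; ring
      linarith
    have h4 : 2 * ((m : ℝ) - 1) * (κ + b' / (8 * m')) ≤ 2 * |(m : ℝ) - 1| * (b' / (4 * m')) := by
      have h5 : 0 ≤ κ + b' / (8 * m') := by positivity
      calc 2 * ((m : ℝ) - 1) * (κ + b' / (8 * m')) ≤ 2 * |(m : ℝ) - 1| * (κ + b' / (8 * m')) := by
            have := le_abs_self ((m : ℝ) - 1); nlinarith
        _ ≤ 2 * |(m : ℝ) - 1| * (b' / (4 * m')) :=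
            mul_le_mul_of_nonneg_left h2 (by positivity)
    have h6 : 2 * |(m : ℝ) - 1| * (b' / (4 * m')) ≤ b' / 2 := by
      have h7 : 2 * |(m : ℝ) - 1| * (b' / (4 * m')) = (|(m : ℝ) - 1| / m') * (b' / 2) := by
        field_simp
        ring
      rw [h7]
      have h8 : |(m : ℝ) - 1| / m' ≤ 1 := (div_le_one hm'0).2 hm'1
      nlinarith
    linarith
  -- apply the scaled excess lemma with the profile `G_{b'} = b' G₁`
  have key := excess_le_of_profile_scaled g hg hc hκ0 hκ1 hRic' hpx hL3 hLp hLm hτ0.le hEp hc0 hc1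
    (G := fun r ↦ -∫ u in r..2, b' * ((∫ t in (0 : ℝ)..u, Real.sinh t ^ k) -
      ∫ t in (0 : ℝ)..2, Real.sinh t ^ k) / Real.sinh u ^ k)
    (G' := fun r ↦ b' * ((∫ t in (0 : ℝ)..r, Real.sinh t ^ k) -
      ∫ t in (0 : ℝ)..2, Real.sinh t ^ k) / Real.sinh r ^ k)
    (G2 := fun r ↦ b' * (1 - ((∫ t in (0 : ℝ)..r, Real.sinh t ^ k) -
      ∫ t in (0 : ℝ)..2, Real.sinh t ^ k) * ((k : ℝ) * (Real.cosh r / Real.sinh r)) / Real.sinh r ^ k))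
    (fun r hr ↦ hasDerivAt_agProfileHyp k b' 2 two_pos (by linarith [hr.1]))
    (fun r hr ↦ hasDerivAt_agProfileHyp_deriv k b' 2 (by linarith [hr.1]))
    (strictAntiOn_agProfileHyp k hb'0 hc0 two_pos le_rfl) (agProfileHyp_apply_self k b' 2 2) hbb'
    (fun r hr ↦ by rw [← hkm]; exact (agProfileHyp_model k b' 2 (hc0.trans hr.1)).symm.le) ?_
  · -- `2c + G_{b'}(c) + τ ≤ ε`
    have hGc : -∫ u in c..2, b' * ((∫ t in (0 : ℝ)..u, Real.sinh t ^ k) -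
        ∫ t in (0 : ℝ)..2, Real.sinh t ^ k) / Real.sinh u ^ k = b' * G₁ c := agProfileHyp_smul k b' 2 2 c
    rw [hGc] at key
    have h1 : b' * G₁ c = ε' / 4 := by rw [hb'_def]; field_simp
    rw [h1] at key
    have h2 : 2 * c = ε' / 4 := by rw [hc_def]; ring
    linarith
  · -- the defect condition `τ < G_{b'}(1) = b' G₁(1)`
    show τ < -∫ u in (1:ℝ)..2, b' * ((∫ t in (0 : ℝ)..u, Real.sinh t ^ k) -
        ∫ t in (0 : ℝ)..2, Real.sinh t ^ k) / Real.sinh u ^ k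
    rw [agProfileHyp_smul k b' 2 2 1]
    exact hτG

end Prop62

section Prop62Scaled

universe u v

/-- **Cheeger–Colding 1996, Prop. 6.2, at an arbitrary scale `R > 0`** (the printed form):
given `m`, `ε > 0` there are `τ(ε, m) > 0`, `L(ε, m)` such that `Ric ≥ -(m-1) τ R⁻²` [(6.3)],
`E(p) ≤ τ R` [(6.4)], `d(p, q±) ≥ L R` [(6.5)] imply `E ≤ ε R` on `B_R(p)` [(6.6)]. From the case
`R = 1` (`cheegerColding_excess_estimate`) applied to the rescaled metric `R⁻² g` ("since the
statement is scale invariant it suffices to assume `R = 1`"). [cite: CheegerColding1996, Prop. 6.2] -/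
theorem cheegerColding_excess_estimate_scaled (m : ℕ) {ε : ℝ} (hε : 0 < ε) :
    ∃ τ : ℝ, 0 < τ ∧ ∃ L : ℝ, 0 < L ∧
      ∀ {E : Type u} [NormedAddCommGroup E] [NormedSpace ℝ E] [FiniteDimensional ℝ E]
        [CompleteSpace E] {M : Type v} [TopologicalSpace M] [ChartedSpace E M]
        [IsManifold 𝓘(ℝ, E) ∞ M] [T2Space M] [ConnectedSpace M]
        (g : PseudoRiemannianMetric 𝓘(ℝ, E) ∞ E (TangentSpace 𝓘(ℝ, E) : M → Type _))
        [g.HasLeviCivita] [CovariantDerivative.ContMDiffCovariantDerivative g.leviCivita 1]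
        [CovariantDerivative.ContMDiffCovariantDerivative g.leviCivita ∞]
        (hg : g.IsRiemannian) (_hc : IsGeodesicallyComplete g.leviCivita)
        (_hdim : Module.finrank ℝ E = m) {R : ℝ} (_hR : 0 < R)
        (_hRic : ∀ (x : M) (w : TangentSpace 𝓘(ℝ, E) x),
          -((m : ℝ) - 1) * (τ * R⁻¹ ^ 2) * g.val x w w ≤ g.leviCivita.ricci x w w)
        (qp qm p : M), ENNReal.ofReal (L * R) ≤ g.edist hg p qp →
          ENNReal.ofReal (L * R) ≤ g.edist hg p qm →
          (g.edist hg qp p).toReal + (g.edist hg qm p).toReal - (g.edist hg qp qm).toReal ≤ τ * R →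
            ∀ x : M, g.edist hg p x < ENNReal.ofReal R →
              (g.edist hg qp x).toReal + (g.edist hg qm x).toReal -
                (g.edist hg qp qm).toReal ≤ ε * R := by
  obtain ⟨τ, hτ, L, hL, H⟩ := cheegerColding_excess_estimate.{u, v} m hε
  refine ⟨τ, hτ, L, hL, ?_⟩
  intro E _ _ _ _ M _ _ _ _ _ g _ _ _ hg hc hdim R hR hRic qp qm p hLp hLm hEp x hpx
  haveI : LocallyCompactSpace M := Manifold.locallyCompact_of_finiteDimensional 𝓘(ℝ, E)
  haveI : RegularSpace M := inferInstance
  -- the rescaled metric `R⁻² g`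
  have hR2 : (0 : ℝ) < R⁻¹ ^ 2 := by positivity
  set g' := g.constSmul (R⁻¹ ^ 2) hR2.ne' with hg'_def
  haveI : g'.HasLeviCivita := HasLeviCivita.constSmul (g := g) (R⁻¹ ^ 2) hR2.ne'
  have hLC : g'.leviCivita = g.leviCivita := leviCivita_constSmul (g := g) (R⁻¹ ^ 2) hR2.ne'
  haveI : CovariantDerivative.ContMDiffCovariantDerivative g'.leviCivita 1 := by
    rw [hLC]; infer_instance
  haveI : CovariantDerivative.ContMDiffCovariantDerivative g'.leviCivita ∞ := by
    rw [hLC]; infer_instance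
  have hg' : g'.IsRiemannian := hg.constSmul hR2
  have hc' : IsGeodesicallyComplete g'.leviCivita := by rw [hLC]; exact hc
  have hRic' : ∀ (y : M) (w : TangentSpace 𝓘(ℝ, E) y),
      -((m : ℝ) - 1) * τ * g'.val y w w ≤ g'.leviCivita.ricci y w w := fun y w ↦ by
    rw [hLC, hg'_def, constSmul_apply]
    have := hRic y w
    nlinarith
  -- distances scale by `R⁻¹`
  have hd0 : ∀ y z : M, g'.edist hg' y z = ENNReal.ofReal R⁻¹ * g.edist hg y z := fun y z ↦ by
    have h := edist_constSmul hg hR2 y z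
    rw [show (g.constSmul (R⁻¹ ^ 2) hR2.ne').edist (hg.constSmul hR2) y z = g'.edist hg' y z from rfl]
      at h
    rw [h, Real.sqrt_sq (inv_nonneg.2 hR.le)]
  have hd : ∀ y z : M, (g'.edist hg' y z).toReal = R⁻¹ * (g.edist hg y z).toReal := fun y z ↦ by
    rw [hd0, ENNReal.toReal_mul, ENNReal.toReal_ofReal (inv_nonneg.2 hR.le)]
  have hofReal : ∀ {s : ℝ} {y z : M}, ENNReal.ofReal (s * R) ≤ g.edist hg y z →
      ENNReal.ofReal s ≤ g'.edist hg' y z := fun {s y z} h ↦ by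
    rw [hd0, show ENNReal.ofReal s = ENNReal.ofReal R⁻¹ * ENNReal.ofReal (s * R) by
      rw [← ENNReal.ofReal_mul (inv_nonneg.2 hR.le)]; congr 1; field_simp]
    exact (ENNReal.mul_le_mul_iff_right (ENNReal.ofReal_pos.2 (inv_pos.2 hR)).ne'
      ENNReal.ofReal_ne_top).2 h
  have key := H g' hg' hc' hdim hRic' qp qm p (hofReal hLp) (hofReal hLm) ?_ x ?_
  · rw [hd, hd, hd] at key
    have h1 : R⁻¹ * ((g.edist hg qp x).toReal + (g.edist hg qm x).toReal -
        (g.edist hg qp qm).toReal) ≤ ε := by linarith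
    rw [inv_mul_le_iff₀ hR] at h1
    linarith
  · rw [hd, hd, hd]
    have h1 : R⁻¹ * ((g.edist hg qp p).toReal + (g.edist hg qm p).toReal -
        (g.edist hg qp qm).toReal) ≤ τ := by
      rw [inv_mul_le_iff₀ hR]; linarith
    linarith
  · rw [hd0, show ENNReal.ofReal 1 = ENNReal.ofReal R⁻¹ * ENNReal.ofReal R by
      rw [← ENNReal.ofReal_mul (inv_nonneg.2 hR.le), inv_mul_cancel₀ hR.ne']]
    exact (ENNReal.mul_lt_mul_iff_right (ENNReal.ofReal_pos.2 (inv_pos.2 hR)).ne'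
      ENNReal.ofReal_ne_top).2 hpx

end Prop62Scaled

end Literature.Geometry.Riemannian

end
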